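import Summits.Ventures.HSemireg.WedgePointPairPowersPerQExtreme

/-!
# Venture HSemireg — per-`q` blocks of the `n`-fold box of `m`-dimensional point pairs, companion: the two EXTREME blocks have
# exactly `C(mn, k)` monomials in degree `k + mn`, so `θ ↦ θ ∧ F` is ONTO them (every `m ≥ 1`, `n`, `k`)

HONEST FRAMING. Part of the Lean index of the computation cell `pub-hsemireg` (seat p10 gen 4, Sunday typer «UNIFORM-IN-n»).
Finite combinatorics of letter sets + the rank theorems of `WedgePointPairPowersPerQExtreme.lean` ONLY: no variety, no cohomology
theory, no sheaf, no Ext group, no semiregularity map is constructed here; nothing here says that HC / HC_CM / HC_AV holds; no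
Literature fact is declared or used.  Dictionary (quoted, NOT asserted): `q` = number of `X`-generators missing from a target monomial
(`WedgePointPairPowersPerQ.qdeg`) ↔ Dolbeault index.

THIS FILE: §1 `YY = XXᶜ` (every generator is an `X`- or a `Y`-letter of its block); §2 the degree-`(k + mn)` monomials of index `0`
are the `E_{XX ⊔ S}`, `S` a `k`-subset of `YY` — **`C(mn, k)` of them** (`card_monomials_qdeg_zero`) — and those of index `mn − k` the
`E_{S ⊔ YY}`, `S` a `k`-subset of `XX` — **`C(mn, k)`** (`card_monomials_qdeg_top`, `k ≤ mn`); §3 hence **the rank of the `q = 0`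
(resp. `q = mn − k`) block of `θ ↦ θ ∧ F ∣ ⋀^k` (`= C(mn, k)`, `WedgePointPairPowersPerQExtreme.lean`) EQUALS the number of monomials
of that block in degree `k + mn`**: the image of `⋀^k` lying in degree `k + mn` (degree bookkeeping, words), the map is ONTO the two
extreme blocks — every monomial containing all `X`-letters (resp. all `Y`-letters) is reached.  The equality of the two numbers is
the theorem; the surjectivity sentence is its reading.  Namespace `Summit.Ventures.HSemireg.Wedge.PairPowers`, new names only.
-/

open Module Set Set.powersetCard Polynomial

namespace Summit.Ventures.HSemireg.Wedge.PairPowers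

open Summit.Ventures.HSemireg.Wedge Summit.Ventures.HSemireg.Wedge.Kunneth

variable (K : Type*) [Field K] {m : ℕ} {n : ℕ}

/-! ## §1. Every generator is an `X`-letter or a `Y`-letter of its block -/

/-- membership in `YY` by value: `x mod 2m ≥ m`. -/
lemma mem_YY {x : Fin ((m + m) * n)} : x ∈ YY m n ↔ m ≤ (x : ℕ) % (m + m) := by
  have hb := two_m_pos x
  rw [YY, glue, Finset.mem_biUnion]
  constructor
  · rintro ⟨i, -, h⟩
    obtain ⟨j, hj, rfl⟩ := mem_lift.mp h
    rw [WedgePair.mem_Yset] at hj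
    rw [blockEmb_val, Nat.mul_add_mod, Nat.mod_eq_of_lt j.2]
    exact hj
  · intro hx
    refine ⟨⟨x / (m + m), div_lt x⟩, Finset.mem_univ _, mem_lift.mpr ⟨⟨x % (m + m), Nat.mod_lt _ hb⟩, ?_, Fin.ext ?_⟩⟩
    · rw [WedgePair.mem_Yset]; exact hx
    · rw [blockEmb_val]; exact Nat.div_add_mod x (m + m)

/-- every generator is an `X`-letter or a `Y`-letter of its block, not both: `YY = XXᶜ`. -/
lemma YY_eq_compl : YY m n = (XX m n)ᶜ := by
  ext x
  rw [mem_YY, Finset.mem_compl, mem_XX, not_lt]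

/-! ## §2–§3. The two extreme blocks have `C(mn, k)` monomials in degree `k + mn`: `θ ↦ θ ∧ F` is ONTO them -/

/-- Dolbeault index `0` means: all `X`-letters present. -/
lemma qdeg_eq_zero_iff {T : Finset (Fin ((m + m) * n))} : qdeg m n T = 0 ↔ XX m n ⊆ T := by
  rw [qdeg, Finset.card_eq_zero, Finset.sdiff_eq_empty_iff_subset]

/-- the degree-`(k + mn)` monomials of Dolbeault index `0` are the `E_{XX ⊔ S}`, `S` a `k`-subset of `YY`: **`C(mn, k)` of them**. -/
theorem card_monomials_qdeg_zero (k : ℕ) :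
    (Finset.univ.filter fun T : Finset (Fin ((m + m) * n)) => T.card = k + m * n ∧ qdeg m n T = 0).card = (m * n).choose k := by
  suffices h : ((YY m n).powersetCard k).card =
      (Finset.univ.filter fun T : Finset (Fin ((m + m) * n)) => T.card = k + m * n ∧ qdeg m n T = 0).card by
    rw [← h, Finset.card_powersetCard, card_YY]
  refine Finset.card_bij' (fun S _ => S ∪ XX m n) (fun T _ => T \ XX m n) (fun S hS => ?_) (fun T hT => ?_)
    (fun S hS => ?_) (fun T hT => ?_)
  · obtain ⟨hS, hc⟩ := Finset.mem_powersetCard.mp hS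
    have hd : Disjoint S (XX m n) := by
      rw [YY_eq_compl] at hS
      exact Finset.disjoint_left.mpr fun x hx hx' => (Finset.mem_compl.mp (hS hx)) hx'
    refine Finset.mem_filter.mpr ⟨Finset.mem_univ _, ?_, qdeg_eq_zero_iff.mpr Finset.subset_union_right⟩
    rw [Finset.card_union_of_disjoint hd, hc, card_XX_eq_card_YY, card_YY]
  · obtain ⟨-, hc, hq⟩ := Finset.mem_filter.mp hT
    have hX : XX m n ⊆ T := qdeg_eq_zero_iff.mp hq
    refine Finset.mem_powersetCard.mpr ⟨?_, ?_⟩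
    · rw [YY_eq_compl]
      exact fun x hx => Finset.mem_compl.mpr (Finset.mem_sdiff.mp hx).2
    · have h1 := Finset.card_sdiff_add_card_inter T (XX m n)
      rw [Finset.inter_eq_right.mpr hX, card_XX_eq_card_YY, card_YY, hc] at h1
      omega
  · obtain ⟨hS, -⟩ := Finset.mem_powersetCard.mp hS
    have hd : Disjoint S (XX m n) := by
      rw [YY_eq_compl] at hS
      exact Finset.disjoint_left.mpr fun x hx hx' => (Finset.mem_compl.mp (hS hx)) hx'
    rw [Finset.union_sdiff_right, Finset.sdiff_eq_self_of_disjoint hd]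
  · obtain ⟨-, -, hq⟩ := Finset.mem_filter.mp hT
    exact Finset.sdiff_union_of_subset (qdeg_eq_zero_iff.mp hq)

/-- Dolbeault index `mn − k` in degree `k + mn` means: all `Y`-letters present (`k ≤ mn`). -/
lemma qdeg_eq_top_iff {k : ℕ} (hk : k ≤ m * n) {T : Finset (Fin ((m + m) * n))} (hc : T.card = k + m * n) :
    qdeg m n T = m * n - k ↔ YY m n ⊆ T := by
  have h1 := Finset.card_sdiff_add_card_inter (XX m n) T
  have h2 := Finset.card_sdiff_add_card_inter T (XX m n)
  have hY : T \ XX m n ⊆ YY m n := by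
    rw [YY_eq_compl]
    exact fun x hx => Finset.mem_compl.mpr (Finset.mem_sdiff.mp hx).2
  rw [card_XX_eq_card_YY, card_YY] at h1
  rw [hc, Finset.inter_comm] at h2
  rw [qdeg]
  constructor
  · intro hq
    have h3 : (T \ XX m n).card = m * n := by omega
    have h4 : T \ XX m n = YY m n := Finset.eq_of_subset_of_card_le hY (by rw [card_YY, h3])
    rw [← h4]
    exact Finset.sdiff_subset
  · intro hYT
    have h4 : YY m n ⊆ T \ XX m n := fun x hx => Finset.mem_sdiff.mpr ⟨hYT hx, by
      rw [YY_eq_compl, Finset.mem_compl] at hx; exact hx⟩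
    have h5 := Finset.card_le_card h4
    have h6 := Finset.card_le_card hY
    rw [card_YY] at h5 h6
    omega

/-- the degree-`(k + mn)` monomials of Dolbeault index `mn − k` are the `E_{S ⊔ YY}`, `S` a `k`-subset of `XX`: **`C(mn, k)` of
them** (`k ≤ mn`). -/
theorem card_monomials_qdeg_top {k : ℕ} (hk : k ≤ m * n) :
    (Finset.univ.filter fun T : Finset (Fin ((m + m) * n)) => T.card = k + m * n ∧ qdeg m n T = m * n - k).card =
      (m * n).choose k := by
  suffices h : ((XX m n).powersetCard k).card =
      (Finset.univ.filter fun T : Finset (Fin ((m + m) * n)) => T.card = k + m * n ∧ qdeg m n T = m * n - k).card by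
    rw [← h, Finset.card_powersetCard, card_XX_eq_card_YY, card_YY]
  have hdXY : Disjoint (XX m n) (YY m n) := by rw [YY_eq_compl]; exact disjoint_compl_right
  refine Finset.card_bij' (fun S _ => S ∪ YY m n) (fun T _ => T \ YY m n) (fun S hS => ?_) (fun T hT => ?_)
    (fun S hS => ?_) (fun T hT => ?_)
  · obtain ⟨hS, hc⟩ := Finset.mem_powersetCard.mp hS
    have hd : Disjoint S (YY m n) := Finset.disjoint_of_subset_left hS hdXY
    have hcard : (S ∪ YY m n).card = k + m * n := by rw [Finset.card_union_of_disjoint hd, hc, card_YY]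
    exact Finset.mem_filter.mpr ⟨Finset.mem_univ _, hcard, (qdeg_eq_top_iff hk hcard).mpr Finset.subset_union_right⟩
  · obtain ⟨-, hc, hq⟩ := Finset.mem_filter.mp hT
    have hYT : YY m n ⊆ T := (qdeg_eq_top_iff hk hc).mp hq
    refine Finset.mem_powersetCard.mpr ⟨?_, ?_⟩
    · intro x hx
      have hx' := (Finset.mem_sdiff.mp hx).2
      rw [YY_eq_compl, Finset.mem_compl, not_not] at hx'
      exact hx'
    · have h1 := Finset.card_sdiff_add_card_inter T (YY m n)
      rw [Finset.inter_eq_right.mpr hYT, card_YY, hc] at h1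
      omega
  · obtain ⟨hS, -⟩ := Finset.mem_powersetCard.mp hS
    rw [Finset.union_sdiff_right, Finset.sdiff_eq_self_of_disjoint (Finset.disjoint_of_subset_left hS hdXY)]
  · obtain ⟨-, hc, hq⟩ := Finset.mem_filter.mp hT
    exact Finset.sdiff_union_of_subset ((qdeg_eq_top_iff hk hc).mp hq)

/-- **the bottom block's rank is the number of degree-`(k + mn)` monomials of index `0`** — so, the image of `⋀^k` under
`θ ↦ θ ∧ F` lying in degree `k + mn`, the map is ONTO the bottom block (`m ≥ 1`, `a, c ≠ 0`; the degree bookkeeping is words,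
the equality of the two numbers is the theorem). -/
theorem finrank_range_blockProj_wedge_pairBox_zero_eq_card_monomials (hm : 1 ≤ m) {a c : K} (ha : a ≠ 0) (hc : c ≠ 0) (k : ℕ) :
    finrank K (LinearMap.range (blockProj K m n 0 ∘ₗ wedge K (Fin ((m + m) * n)) k (pairBox K (m := m) (n := n) a c))) =
      (Finset.univ.filter fun T : Finset (Fin ((m + m) * n)) => T.card = k + m * n ∧ qdeg m n T = 0).card := by
  rw [finrank_range_blockProj_wedge_pairBox_zero K hm ha hc, card_monomials_qdeg_zero]

/-- **the top block's rank is the number of degree-`(k + mn)` monomials of index `mn − k`** (`k ≤ mn`; same reading). -/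
theorem finrank_range_blockProj_wedge_pairBox_top_eq_card_monomials (hm : 1 ≤ m) {a c : K} (ha : a ≠ 0) (hc : c ≠ 0) {k : ℕ}
    (hk : k ≤ m * n) :
    finrank K (LinearMap.range (blockProj K m n (m * n - k) ∘ₗ
        wedge K (Fin ((m + m) * n)) k (pairBox K (m := m) (n := n) a c))) =
      (Finset.univ.filter fun T : Finset (Fin ((m + m) * n)) => T.card = k + m * n ∧ qdeg m n T = m * n - k).card := by
  rw [finrank_range_blockProj_wedge_pairBox_top K hm ha hc, card_monomials_qdeg_top hk]


end Summit.Ventures.HSemireg.Wedge.PairPowers
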